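import Literature.Probability.Percolation.FivePointCoreTriples
import HarnessLib

/-!
# Five-point discrete holomorphicity, III: the re-linking triples (HT3) and (H) for every five-marked domain

Topic `Literature/Probability/Percolation`; lane pcv-sawmu (CriticalPhenomena), door (v). THE PLANAR FACE HT3 `ReLinkingTriples`
(statement pcv-sawmu b-step0 g9 / a-p4 g6; proof b-engine-2 g6) and the theorem
`hexFivePointHolomorphy_holds : ∀ D c j v, hexFaceVertices v ⊆ D.verts → Σ_{k : Fin 3} τ^k · sparseObs D j c v (ccwNbr v k) = 0`
(the lane's typed statement (H), spelled out). HT3 without a new Jordan-curve lemma: for a core `ζ` at the interior face `v` with three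
odd neighbours and partners `p` (`oppFace v k ~ y_{p k}`), odd-face counting gives `p` injective and the two left-over corners linked to
each other; for each `k` the REDUCED CONFIGURATION `L_k` = (ζ minus the path of `oppFace v k`) ∪ {side v (k+1), side v (k+2)} lies in
`loopSpace D (p k)`, hence is the loop configuration of a colouring `σ_k` (`loopSurj_holds`). NON-CROSSING (achiral) is the five-marked
loop lemma read in `σ_k` (`fiveMarkedLoopLemma_holds`); CHIRALITY comes from Bollobás–Riordan's ORIENTED interface walk
(`TriDiscInterface`: exit sides keep black on the right; a face is entered through at most one side): the deleted path is white in
`σ_k`, so the lone hexagon `faceVertex v k` is black and the walk from `y_{p k + 1}` enters `v` from `oppFace v (k+1)` — its initial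
segment is a core chain, whence `p (k+1) = p k + 1` whenever `y_{p k + 1}` is a neighbour's corner. A finite lemma on `Fin 5`
(`ht3_fl_main`, by `decide`) converts three non-crossing and three chirality conditions into the frozen conclusion; the classes of the
three completions are read with the attachment lemma. Status in print (lane label cell, lit-2 22:58:02Z): the SHAPE is printed —
Khristoforov–Smirnov 2021 Lemma 4 (discrete holomorphicity; arXiv:2111.15612 §2, Definition 3 + Lemma 4, p. 5) is the three-term
`τ`-weighted relation for the observable `F` with THREE boundary disorders, itself the exact form of Smirnov's 2001 relation (C. R. Acad.
Sci. Paris 333); KhS's `F` carries the weights `(τ, τ², 1)` on the three link classes `z ↔ u_j`, whereas `sparseObs` carries `(1, −τ², −τ)` on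
the classes `(j, A), (j+1, B), (j−1, B)` — it mixes an `A`-class and two `B`-classes, so the five-mark observable is not `F` with two marks
forgotten and (H) is not an instance of Lemma 4; the lane's observable and the relation with FIVE boundary marks are not located in print
(KhS21 §1 p. 3 announces multi-point generalisations). Provenance: found blind by the lane (MINING-PREREG Am. AE family;
kernel instances `FivePointHolomorphyHexBall1.lean`), orientation-sensitive exactly as print's anticlockwise convention (the mirror weights
fail), false for the `ℤ²` bond analogue; first proof text, for every finite five-marked domain.

## References
* M. Khristoforov, S. Smirnov, *Percolation and O(1) loop model*, arXiv:2111.15612 (2021), §1.2 (Lemma 2); §2 Definition 3 and Lemma 4, p. 5.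
* S. Smirnov, *Critical percolation in the plane: conformal invariance, Cardy's formula, scaling limits*, C. R. Acad. Sci. Paris 333 (2001) 239–244.
* B. Bollobás, O. Riordan, *Percolation*, Cambridge University Press (2006), Ch. 7 Lemma 5 pp. 169–171, Fig. 9 (the oriented interface).
-/

open Finset

/-! # ═══════════════════════ HT3 `ReLinkingTriples` ∀ D (pcv-sawmu b-engine-2 gen 6) ═══════════════════════

THE PLANAR FACE, without a new Jordan-curve lemma. Fix the core `ζ` at the interior face `v` with all three neighbours odd and
partners `p : Fin 3 → Fin 5` (`oppFace v k ~ y_{p k}`). Odd-face counting in the core (`odd_component`): `p` is injective, a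
neighbour sees no other corner and no other neighbour, and the two left-over corners `a, b` are linked to each other. For each `k`
the REDUCED CONFIGURATION `L_k := (ζ minus the path of oppFace v k) ∪ {side v (k+1), side v (k+2)}` lies in `loopSpace D (p k)`
(four odd corners), so it is the loop configuration of a colouring `σ_k` (`loopSurj_holds`); in `L_k` the corner pairs are
`{a, b}` and `{p (k+1), p (k+2)}` (the latter through `v`, `ht2_reach_attach`). Two readings of `σ_k`:
* NON-CROSSING (achiral): the five-marked LOOP LEMMA (`fiveMarkedLoopLemma_holds`) says the pairing is `A_{p k}` or `B_{p k}`;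
* CHIRALITY: the path of `oppFace v k` is WHITE in `σ_k` (its faces have `L_k`-degree `0`, and `y_{p k}` sees the two white arcs
  `p k - 1`, `p k`), so the lone hexagon `faceVertex v k` is BLACK; Bollobás–Riordan's ORIENTED interface walk from `y_{p k + 1}`
  (`TriDiscInterface`: exit sides keep black on the right, a face is entered through at most one side) therefore enters `v` from
  `oppFace v (k+1)`; its initial segment is a `ζ`-chain, so `p (k+1) = p k + 1` whenever `y_{p k + 1}` lies on the path through `v`.
A finite lemma on `Fin 5` (`ht3_fl_main`, `decide`) turns the three non-crossing and three chirality conditions into the frozen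
conclusion (`{a, b} = {c, c+1}`, `p` = `(c+2, c+3, c+4)` up to rotation); the classes of the three completions are then read with
`ht2_reach_attach`. Final: `reLinkingTriples_holds` and `hexFivePointHolomorphy_holds`. -/

namespace Literature.Probability.Percolation.FivePoint

open Finset Literature.Probability.Percolation Literature.Probability.LatticeModels Literature.Probability.Percolation.FivePoint TriMarkedDomain

variable (D : TriMarkedDomain 5)

namespace N5

/-! #### HT3-0. Finite combinatorics on `Fin 5` / `Fin 3` -/

/-- linked corner pairs among the four corners other than the reference: `{a, b}` or `{q₁, q₂}`. [cite: KhristoforovSmirnov2021, Lemma 4 (discrete holomorphicity: the triple bijection at a vertex)] -/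
def Ht3LP (a b q₁ q₂ x y : Fin 5) : Prop :=
  (x = a ∧ y = b) ∨ (x = b ∧ y = a) ∨ (x = q₁ ∧ y = q₂) ∨ (x = q₂ ∧ y = q₁)

/-- (H) bookkeeping. [folklore] -/
instance (a b q₁ q₂ x y : Fin 5) : Decidable (Ht3LP a b q₁ q₂ x y) := by
  unfold Ht3LP; infer_instance

/-- the NON-CROSSING condition at reference `q₀` (pattern `A_{q₀}` or `B_{q₀}` of the loop lemma). [cite: KhristoforovSmirnov2021, §1.2 Lemma 2] -/
def Ht3NC (a b q₀ q₁ q₂ : Fin 5) : Prop :=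
  Ht3LP a b q₁ q₂ (q₀ + 1) (q₀ + 2) ∨ Ht3LP a b q₁ q₂ (q₀ + 1) (q₀ + 4)

/-- (H) bookkeeping. [folklore] -/
instance (a b q₀ q₁ q₂ : Fin 5) : Decidable (Ht3NC a b q₀ q₁ q₂) := by
  unfold Ht3NC; infer_instance

/-- the CHIRALITY condition at the neighbour with partner `q₀`, the next neighbour anticlockwise having partner `q₁`. [cite: BollobasRiordan2006, Ch. 7 Lemma 5 pp. 169–171] -/
def Ht3Chi (q₀ q₁ q₂ : Fin 5) : Prop := (q₀ + 1 = q₁ ∨ q₀ + 1 = q₂) → q₁ = q₀ + 1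

/-- (H) bookkeeping. [folklore] -/
instance (q₀ q₁ q₂ : Fin 5) : Decidable (Ht3Chi q₀ q₁ q₂) := by
  unfold Ht3Chi; infer_instance

/-- three values miss some point of `Fin 5`. [cite: BollobasRiordan2006, Ch. 7 §7.2.2 pp. 168–171] -/
private theorem ht3_fl_free (p₀ p₁ p₂ : Fin 5) : ∃ a : Fin 5, a ≠ p₀ ∧ a ≠ p₁ ∧ a ≠ p₂ := by
  revert p₀ p₁ p₂; decide

set_option maxRecDepth 4000 in
/-- five distinct values exhaust `Fin 5`. [cite: BollobasRiordan2006, Ch. 7 §7.2.2 pp. 168–171] -/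
private theorem ht3_fl_cover (p₀ p₁ p₂ a b : Fin 5) (hab : a ≠ b) (ha0 : a ≠ p₀) (ha1 : a ≠ p₁) (ha2 : a ≠ p₂)
    (hb0 : b ≠ p₀) (hb1 : b ≠ p₁) (hb2 : b ≠ p₂) (h01 : p₀ ≠ p₁) (h02 : p₀ ≠ p₂) (h12 : p₁ ≠ p₂)
    (x : Fin 5) : x = a ∨ x = b ∨ x = p₀ ∨ x = p₁ ∨ x = p₂ := by
  revert p₀ p₁ p₂ a b x; decide

set_option maxRecDepth 4000 in
/-- **the finite heart of HT3**: three non-crossing conditions and three chirality conditions force the left-over pair to be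
adjacent and the partners to increase anticlockwise. [cite: KhristoforovSmirnov2021, Lemma 4 (discrete holomorphicity: the triple bijection at a vertex)] -/
theorem ht3_fl_main (p₀ p₁ p₂ a b : Fin 5) (hab : a ≠ b) (ha0 : a ≠ p₀) (ha1 : a ≠ p₁) (ha2 : a ≠ p₂)
    (hb0 : b ≠ p₀) (hb1 : b ≠ p₁) (hb2 : b ≠ p₂) (h01 : p₀ ≠ p₁) (h02 : p₀ ≠ p₂) (h12 : p₁ ≠ p₂)
    (n0 : Ht3NC a b p₀ p₁ p₂) (n1 : Ht3NC a b p₁ p₂ p₀) (n2 : Ht3NC a b p₂ p₀ p₁)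
    (c0 : Ht3Chi p₀ p₁ p₂) (c1 : Ht3Chi p₁ p₂ p₀) (c2 : Ht3Chi p₂ p₀ p₁) :
    ∃ c : Fin 5, ((a = c ∧ b = c + 1) ∨ (a = c + 1 ∧ b = c)) ∧
      ((p₀ = c + 2 ∧ p₁ = c + 3 ∧ p₂ = c + 4) ∨ (p₁ = c + 2 ∧ p₂ = c + 3 ∧ p₀ = c + 4) ∨
        (p₂ = c + 2 ∧ p₀ = c + 3 ∧ p₁ = c + 4)) := by
  revert p₀ p₁ p₂ a b; decide

/-- the three elements of `Fin 3` from any start. [cite: BollobasRiordan2006, Ch. 7 §7.2.2 pp. 168–171] -/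
private theorem ht3_fin3_cases (k j : Fin 3) : j = k ∨ j = k + 1 ∨ j = k + 2 := by
  revert k j; decide

/-- `k`, `k + 1`, `k + 2` are distinct. [cite: BollobasRiordan2006, Ch. 7 §7.2.2 pp. 168–171] -/
private theorem ht3_fin3_ne (k : Fin 3) : k + 1 ≠ k ∧ k + 2 ≠ k ∧ k + 1 ≠ k + 2 := by
  revert k; decide

/-- two distinct vertices of a face span one of its sides. [cite: BollobasRiordan2006, Ch. 7 §7.2.2 pp. 168–171] -/
theorem ht3_pair_eq_side (F : HexVertex) {i w : Fin 3} (h : i ≠ w) : ∃ j : Fin 3, s(faceVertex F i, faceVertex F w) = side F j := by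
  unfold side
  rcases ht3_fin3_cases i w with e | e | e
  · exact absurd e.symm h
  · subst e
    refine ⟨i + 2, ?_⟩
    rw [fin3_add_two_add_one, fin3_add_two_add_two]
  · subst e
    refine ⟨i + 1, ?_⟩
    rw [fin3_add_one_add_one, fin3_add_one_add_two, Sym2.eq_swap]

/-! #### HT3-1. Odd-face counting in a core with three odd neighbours -/

section Core

variable {D}
variable {v : HexVertex} (hv : hexFaceVertices v ⊆ D.verts) {ζ : Finset (Sym2 (Site 2))} (hq : IsCore D v Finset.univ ζ)
  {p : Fin 3 → Fin 5} (hp : ∀ k : Fin 3, (sideGraph ζ).Reachable (oppFace v k) (yc D (p k)))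
include hv hq hp

/-- a neighbour sees only its own corner. [cite: KhristoforovSmirnov2021, Lemma 4 (discrete holomorphicity: the triple bijection at a vertex)] -/
theorem ht3_opp_corner {k : Fin 3} {a : Fin 5} (h : (sideGraph ζ).Reachable (oppFace v k) (yc D a)) : a = p k := by
  by_contra hne
  exact ht2_no_three D hq (ht2_opp_touching D hv k) (ht2_odd_opp D hv hq (Finset.mem_univ k)) (ht2_odd_yc D hq (p k))
    (ht2_odd_yc D hq a) (hp k) h (ht2_opp_ne_yc D hv k (p k)) (ht2_opp_ne_yc D hv k a)
    (fun e => hne (yc_injective D e).symm)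

/-- the partners are distinct. [cite: KhristoforovSmirnov2021, Lemma 4 (discrete holomorphicity: the triple bijection at a vertex)] -/
theorem ht3_p_injective : Function.Injective p := by
  intro k k' h
  by_contra hne
  have h1 : (sideGraph ζ).Reachable (yc D (p k)) (oppFace v k) := (hp k).symm
  have h2 : (sideGraph ζ).Reachable (yc D (p k)) (oppFace v k') := by rw [h]; exact (hp k').symm
  exact ht2_no_three D hq (yc_mem_touching D (p k)) (ht2_odd_yc D hq (p k)) (ht2_odd_opp D hv hq (Finset.mem_univ k))
    (ht2_odd_opp D hv hq (Finset.mem_univ k')) h1 h2 (ht2_opp_ne_yc D hv k (p k)).symm (ht2_opp_ne_yc D hv k' (p k)).symm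
    (fun e => hne (oppFace_injective' v e))

/-- a neighbour sees no other neighbour. [cite: KhristoforovSmirnov2021, Lemma 4 (discrete holomorphicity: the triple bijection at a vertex)] -/
theorem ht3_opp_opp {k k' : Fin 3} (hne : k ≠ k') : ¬ (sideGraph ζ).Reachable (oppFace v k) (oppFace v k') := fun h =>
  ht2_no_three D hq (ht2_opp_touching D hv k) (ht2_odd_opp D hv hq (Finset.mem_univ k)) (ht2_odd_yc D hq (p k))
    (ht2_odd_opp D hv hq (Finset.mem_univ k')) (hp k) h (ht2_opp_ne_yc D hv k (p k))
    (fun e => hne (oppFace_injective' v e)) (ht2_opp_ne_yc D hv k' (p k)).symm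

/-- **the left-over corners pair up**: a corner which is nobody's partner is linked to another such corner. [cite: KhristoforovSmirnov2021, Lemma 4 (discrete holomorphicity: the triple bijection at a vertex)] -/
theorem ht3_free_partner {a : Fin 5} (ha : ∀ k, a ≠ p k) :
    ∃ b : Fin 5, b ≠ a ∧ (∀ k, b ≠ p k) ∧ (sideGraph ζ).Reachable (yc D a) (yc D b) := by
  classical
  obtain ⟨hζ, -⟩ := ha_core_sub D hq
  obtain ⟨⟨Y, hYne, hYodd, hYr⟩, -⟩ :=
    odd_component D hζ (ha_core_deg_le_two D hq) (yc_mem_touching D a) (ht2_odd_yc D hq a)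
  have hYt : Y ∈ triFacesTouching D.verts := touching_of_reachable D hζ (yc_mem_touching D a) hYr
  have hYmem := (hq.2.2 Y hYt).1 hYodd
  rcases Finset.mem_union.1 hYmem with hc | hx
  · obtain ⟨b, rfl⟩ := (mem_corners D).1 hc
    refine ⟨b, fun e => hYne (by rw [e]), fun k e => ?_, hYr⟩
    -- `b = p k`: the component of `y_{p k}` would carry `y_{p k}`, `oppFace v k`, `y_a`
    have h1 : (sideGraph ζ).Reachable (yc D (p k)) (oppFace v k) := (hp k).symm
    have h2 : (sideGraph ζ).Reachable (yc D (p k)) (yc D a) := by rw [← e]; exact hYr.symm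
    exact ht2_no_three D hq (yc_mem_touching D (p k)) (ht2_odd_yc D hq (p k)) (ht2_odd_opp D hv hq (Finset.mem_univ k))
      (ht2_odd_yc D hq a) h1 h2 (ht2_opp_ne_yc D hv k (p k)).symm (fun e' => ha k (yc_injective D e').symm)
      (ht2_opp_ne_yc D hv k a)
  · obtain ⟨i, -, rfl⟩ := Finset.mem_image.1 hx
    exact absurd (ht3_opp_corner hv hq hp hYr.symm) (ha i)

end Core

/-! #### HT3-2. The reduced configuration `L_k`: delete the path of `oppFace v k`, attach `v` to the two other neighbours -/

open Classical in
/-- the core minus the component of `oppFace v k`. [cite: KhristoforovSmirnov2021, Lemma 4 (discrete holomorphicity: the triple bijection at a vertex)] -/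
noncomputable def ht3zk (ζ : Finset (Sym2 (Site 2))) (v : HexVertex) (k : Fin 3) : Finset (Sym2 (Site 2)) :=
  ζ.filter fun e => ¬ ∃ F, (sideGraph ζ).Reachable (oppFace v k) F ∧ ∃ i : Fin 3, e = side F i

/-- the reduced configuration `L_k`. [cite: KhristoforovSmirnov2021, Lemma 4 (discrete holomorphicity: the triple bijection at a vertex)] -/
noncomputable def ht3Lk (ζ : Finset (Sym2 (Site 2))) (v : HexVertex) (k : Fin 3) : Finset (Sym2 (Site 2)) :=
  ht3zk ζ v k ∪ (Finset.univ.erase k).image (side v)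

/-- membership in `ht3zk`. [cite: KhristoforovSmirnov2021, §1.2 (loop configurations, pp. 3–4)] -/
theorem ht3_mem_zk (ζ : Finset (Sym2 (Site 2))) (v : HexVertex) (k : Fin 3) (e : Sym2 (Site 2)) :
    e ∈ ht3zk ζ v k ↔ e ∈ ζ ∧ ¬ ∃ F, (sideGraph ζ).Reachable (oppFace v k) F ∧ ∃ i : Fin 3, e = side F i := by
  classical
  unfold ht3zk
  rw [Finset.mem_filter]

/-- `ht3zk ⊆ ζ`. [cite: KhristoforovSmirnov2021, §1.2 (loop configurations, pp. 3–4)] -/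
theorem ht3_zk_subset (ζ : Finset (Sym2 (Site 2))) (v : HexVertex) (k : Fin 3) : ht3zk ζ v k ⊆ ζ := by
  classical
  unfold ht3zk
  exact Finset.filter_subset _ _

section Reduced

variable {D}
variable {v : HexVertex} (hv : hexFaceVertices v ⊆ D.verts) {ζ : Finset (Sym2 (Site 2))} (hq : IsCore D v Finset.univ ζ)
  {p : Fin 3 → Fin 5} (hp : ∀ k : Fin 3, (sideGraph ζ).Reachable (oppFace v k) (yc D (p k)))
include hv hq hp

/-- faces on the path of `oppFace v k` have no side in `L_k`. [cite: KhristoforovSmirnov2021, Lemma 4 (discrete holomorphicity: the triple bijection at a vertex)] -/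
theorem ht3_no_side_of_reach (k : Fin 3) {F : HexVertex} (hF : (sideGraph ζ).Reachable (oppFace v k) F) (i : Fin 3) :
    side F i ∉ ht3Lk ζ v k := by
  classical
  obtain ⟨hζ, hside⟩ := ha_core_sub D hq
  obtain ⟨hz0, -, -⟩ := restrict_off_component D hζ (oppFace v k) (ht3zk ζ v k) (ht3_mem_zk ζ v k)
  intro hmem
  unfold ht3Lk at hmem
  rcases Finset.mem_union.1 hmem with h | h
  · have h0 := hz0 F hF
    rw [l1_xiDeg_eq, Finset.card_eq_zero, Finset.filter_eq_empty_iff] at h0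
    exact h0 (Finset.mem_univ i) h
  · obtain ⟨i', hi', he⟩ := Finset.mem_image.1 h
    have hFt : F ∈ triFacesTouching D.verts := mem_touching_of_side_mem D (he ▸ ht2_side_mem_hBonds D hv i')
    rcases (l3_exists_side_eq_iff D (ht2_side_mem_hBonds D hv i') hFt).1 ⟨i, he.symm⟩ with hFv | hFo
    · -- `F = v`: but `v` is not reachable from `oppFace v k`
      rw [hFv] at hF
      exact (hexGraph_adj_oppFace v k).ne (ht2_reach_v D hq hF.symm).symm
    · rw [hFo] at hF
      exact ht3_opp_opp hv hq hp (fun e => (Finset.mem_erase.1 hi').1 e.symm) hF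

omit hv hp in
/-- `v` has no side in a core. [cite: KhristoforovSmirnov2021, Lemma 4 (discrete holomorphicity: the triple bijection at a vertex)] -/
theorem ht3_xiDeg_v : xiDeg ζ v = 0 := by
  classical
  rw [l1_xiDeg_eq, Finset.card_eq_zero, Finset.filter_eq_empty_iff]
  intro j _ hj
  exact (ha_core_sub D hq).2 j hj

omit hv hq hp in
/-- small `Fin 5` facts about a reference corner. [cite: BollobasRiordan2006, Ch. 7 §7.2.2 pp. 168–171] -/
private theorem ht3_fin5_facts (r : Fin 5) : r + 1 ≠ r ∧ r + 2 ≠ r ∧ r + 4 ≠ r ∧ r + 2 ≠ r + 1 ∧ r + 4 ≠ r + 1 := by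
  revert r; decide

/-- **the reduced configuration has its four odd faces at the corners other than `y_{p k}`.** [cite: KhristoforovSmirnov2021, §1.2 (loop configurations, pp. 3–4)] -/
theorem ht3_Lk_mem_loopSpace (k : Fin 3) : ht3Lk ζ v k ∈ loopSpace D (p k) := by
  classical
  obtain ⟨hζ, hside⟩ := ha_core_sub D hq
  obtain ⟨hz0, hzs, -⟩ := restrict_off_component D hζ (oppFace v k) (ht3zk ζ v k) (ht3_mem_zk ζ v k)
  have hzsub : ht3zk ζ v k ⊆ ζ := ht3_zk_subset ζ v k
  have hzside : ∀ j : Fin 3, side v j ∉ ht3zk ζ v k := fun j h => hside j (hzsub h)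
  have hpar := hq.2.2
  unfold loopSpace
  rw [Finset.mem_filter, Finset.mem_powerset]
  constructor
  · intro e he
    unfold ht3Lk at he
    rcases Finset.mem_union.1 he with h | h
    · exact hζ (hzsub h)
    · obtain ⟨i, -, rfl⟩ := Finset.mem_image.1 h
      exact ht2_side_mem_hBonds D hv i
  · intro F hF
    unfold ht3Lk
    rw [ht2_union_eq_symmDiff hzside, xorDeg_holds]
    have hR : (∃ j : Fin 5, j ≠ p k ∧ IsCornerFace D j F) ↔ (∃ j : Fin 5, j ≠ p k ∧ F = yc D j) := by
      simp only [isCornerFace_iff_eq_yc]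
    rw [hR]
    by_cases hFv : F = v
    · rw [hFv, ht2_xiDeg_image_v]
      have hv0 : ¬ (sideGraph ζ).Reachable (oppFace v k) v := fun h =>
        (hexGraph_adj_oppFace v k).ne (ht2_reach_v D hq h.symm).symm
      rw [hzs v hv0, ht3_xiDeg_v hq]
      have hcard : #((Finset.univ : Finset (Fin 3)).erase k) = 2 := by
        rw [Finset.card_erase_of_mem (Finset.mem_univ k), Finset.card_univ, Fintype.card_fin]
      rw [hcard]
      constructor
      · intro h; exact absurd (iff_of_false (by decide) (by decide)) h
      · rintro ⟨j, -, hj⟩; exact absurd hj.symm (ht2_yc_ne_v D hv j)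
    · by_cases hFr : (sideGraph ζ).Reachable (oppFace v k) F
      · rw [hz0 F hFr, ht2_odd_xiDeg_image_iff D hv _ hF hFv]
        have hno : ¬ ∃ i ∈ (Finset.univ : Finset (Fin 3)).erase k, F = oppFace v i := by
          rintro ⟨i, hi, rfl⟩
          exact ht3_opp_opp hv hq hp (fun e => (Finset.mem_erase.1 hi).1 e.symm) hFr
        constructor
        · intro h; exact absurd (iff_of_false (by decide) hno) h
        · rintro ⟨j, hj, rfl⟩; exact absurd (ht3_opp_corner hv hq hp hFr) hj
      · rw [hzs F hFr, hpar F hF, ht2_odd_xiDeg_image_iff D hv _ hF hFv, Finset.mem_union]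
        by_cases hFo : ∃ i ∈ (Finset.univ : Finset (Fin 3)).erase k, F = oppFace v i
        · obtain ⟨i, hi, rfl⟩ := hFo
          have hin : oppFace v i ∈ (Finset.univ : Finset (Fin 3)).image (oppFace v) :=
            Finset.mem_image.2 ⟨i, Finset.mem_univ _, rfl⟩
          have hyes : ∃ i' ∈ (Finset.univ : Finset (Fin 3)).erase k, oppFace v i = oppFace v i' := ⟨i, hi, rfl⟩
          constructor
          · intro h; exact absurd (iff_of_true (Or.inr hin) hyes) h
          · rintro ⟨j, -, hj⟩; exact absurd hj (ht2_opp_ne_yc D hv i j)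
        · rw [ht2_not_iff_of_not hFo]
          constructor
          · rintro (hc | hx)
            · obtain ⟨j, rfl⟩ := (mem_corners D).1 hc
              exact ⟨j, fun e => hFr (by rw [e]; exact hp k), rfl⟩
            · obtain ⟨i, -, rfl⟩ := Finset.mem_image.1 hx
              exfalso
              by_cases hik : i = k
              · apply hFr; rw [hik]
              · exact hFo ⟨i, Finset.mem_erase.2 ⟨hik, Finset.mem_univ _⟩, rfl⟩
          · rintro ⟨j, -, rfl⟩
            exact Or.inl (yc_mem_corners D j)

/-- `L_k ⊆ hBonds`. [cite: KhristoforovSmirnov2021, §1.2 (loop configurations, pp. 3–4)] -/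
theorem ht3_Lk_subset (k : Fin 3) : ht3Lk ζ v k ⊆ hBonds D := by
  classical
  have h := ht3_Lk_mem_loopSpace hv hq hp k
  unfold loopSpace at h
  exact Finset.mem_powerset.1 (Finset.mem_filter.1 h).1

/-- **the reduced configuration is the loop configuration of a colouring** (`LoopSurj`). [cite: KhristoforovSmirnov2021, p. 4 (the colouring ↔ loop-configuration bijection)] -/
theorem ht3_exists_sigma (k : Fin 3) : ∃ σ : SiteConfig (Site 2), xiOf D σ (p k) false = ht3Lk ζ v k :=
  loopSurj_holds D (p k) false _ (ht3_Lk_mem_loopSpace hv hq hp k)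

/-- degrees in the reduced configuration are at most two. [cite: KhristoforovSmirnov2021, §1.2 (loop configurations, pp. 3–4)] -/
theorem ht3_Lk_deg (k : Fin 3) (F : HexVertex) : xiDeg (ht3Lk ζ v k) F ≤ 2 := by
  obtain ⟨σ, hσ⟩ := ht3_exists_sigma hv hq hp k
  rw [← hσ, xiDeg_xiOf]
  exact loopDegLeTwo_holds D σ (p k) false F

/-- the corners other than `y_{p k}` are odd in `L_k`. [cite: KhristoforovSmirnov2021, §1.2 (loop configurations, pp. 3–4)] -/
theorem ht3_Lk_odd_yc (k : Fin 3) {j : Fin 5} (hj : j ≠ p k) : Odd (xiDeg (ht3Lk ζ v k) (yc D j)) := by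
  classical
  have h := ht3_Lk_mem_loopSpace hv hq hp k
  unfold loopSpace at h
  exact ((Finset.mem_filter.1 h).2 (yc D j) (yc_mem_touching D j)).2 ⟨j, hj, yc_spec D j⟩

/-- **no three corners in one component of `L_k`.** [cite: KhristoforovSmirnov2021, §1.2 (loop configurations, pp. 3–4)] -/
theorem ht3_Lk_no_three (k : Fin 3) {x y z : Fin 5} (hx : x ≠ p k) (hy : y ≠ p k) (hz : z ≠ p k) (hxy : x ≠ y)
    (hxz : x ≠ z) (hyz : y ≠ z) (rxy : (sideGraph (ht3Lk ζ v k)).Reachable (yc D x) (yc D y))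
    (rxz : (sideGraph (ht3Lk ζ v k)).Reachable (yc D x) (yc D z)) : False :=
  hyz (yc_injective D ((odd_component D (ht3_Lk_subset hv hq hp k) (ht3_Lk_deg hv hq hp k) (yc_mem_touching D x)
    (ht3_Lk_odd_yc hv hq hp k hx)).2 (yc D y) (yc D z) rxy rxz (ht3_Lk_odd_yc hv hq hp k hy) (ht3_Lk_odd_yc hv hq hp k hz)
    (fun e => hxy (yc_injective D e).symm) (fun e => hxz (yc_injective D e).symm)))

omit hv hp in
/-- links of the core off the deleted path survive in `L_k`. [cite: KhristoforovSmirnov2021, §1.2 (loop configurations, pp. 3–4)] -/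
theorem ht3_Lk_reach_of_reach (k : Fin 3) {Y Y' : HexVertex} (hY : ¬ (sideGraph ζ).Reachable (oppFace v k) Y)
    (h : (sideGraph ζ).Reachable Y Y') : (sideGraph (ht3Lk ζ v k)).Reachable Y Y' := by
  obtain ⟨hζ, -⟩ := ha_core_sub D hq
  obtain ⟨-, -, hzl⟩ := restrict_off_component D hζ (oppFace v k) (ht3zk ζ v k) (ht3_mem_zk ζ v k)
  have h' : (sideGraph (ht3zk ζ v k)).Reachable Y Y' := by
    rw [← xiLinked_iff_reachable] at h ⊢
    exact (hzl Y Y' hY).1 h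
  exact h'.mono (ht2_sideGraph_mono (by unfold ht3Lk; exact Finset.subset_union_left))

/-- the two other neighbours' corners are linked through `v` in `L_k`. [cite: KhristoforovSmirnov2021, Lemma 4 (discrete holomorphicity: the triple bijection at a vertex)] -/
theorem ht3_Lk_reach_pp (k : Fin 3) : (sideGraph (ht3Lk ζ v k)).Reachable (yc D (p (k + 1))) (yc D (p (k + 2))) := by
  classical
  obtain ⟨hζ, hside⟩ := ha_core_sub D hq
  obtain ⟨-, -, hzl⟩ := restrict_off_component D hζ (oppFace v k) (ht3zk ζ v k) (ht3_mem_zk ζ v k)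
  have hzside : ∀ j : Fin 3, side v j ∉ ht3zk ζ v k := fun j h => hside j (ht3_zk_subset ζ v k h)
  obtain ⟨hk1, hk2, hk12⟩ := ht3_fin3_ne k
  have h1 : (sideGraph (ht3zk ζ v k)).Reachable (yc D (p (k + 1))) (oppFace v (k + 1)) := by
    have hnr : ¬ (sideGraph ζ).Reachable (oppFace v k) (yc D (p (k + 1))) := fun h =>
      hk1 (ht3_p_injective hv hq hp (ht3_opp_corner hv hq hp h))
    rw [← xiLinked_iff_reachable]
    exact (hzl _ _ hnr).1 ((xiLinked_iff_reachable _ _ _).2 (hp (k + 1)).symm)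
  have h2 : (sideGraph (ht3zk ζ v k)).Reachable (oppFace v (k + 2)) (yc D (p (k + 2))) := by
    have hnr : ¬ (sideGraph ζ).Reachable (oppFace v k) (oppFace v (k + 2)) := ht3_opp_opp hv hq hp hk2.symm
    rw [← xiLinked_iff_reachable]
    exact (hzl _ _ hnr).1 ((xiLinked_iff_reachable _ _ _).2 (hp (k + 2)))
  unfold ht3Lk
  exact (ht2_reach_attach D hv hzside (Finset.univ.erase k) (ht2_yc_ne_v D hv (p (k + 1))) (yc D (p (k + 2)))).2
    (Or.inl ⟨ht2_yc_ne_v D hv (p (k + 2)), Or.inr ⟨k + 1, Finset.mem_erase.2 ⟨hk1, Finset.mem_univ _⟩, k + 2,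
      Finset.mem_erase.2 ⟨hk2, Finset.mem_univ _⟩, h1, h2⟩⟩)

/-- the corners other than `y_{p k}` are `a`, `b`, `p (k+1)`, `p (k+2)`. [cite: KhristoforovSmirnov2021, Lemma 4 (discrete holomorphicity: the triple bijection at a vertex)] -/
theorem ht3_cover_k (k : Fin 3) {a b : Fin 5} (hab : a ≠ b) (ha : ∀ k', a ≠ p k') (hb : ∀ k', b ≠ p k') (x : Fin 5)
    (hx : x ≠ p k) : x = a ∨ x = b ∨ x = p (k + 1) ∨ x = p (k + 2) := by
  have hinj := ht3_p_injective hv hq hp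
  have h01 : p 0 ≠ p 1 := fun e => absurd (hinj e) (by decide)
  have h02 : p 0 ≠ p 2 := fun e => absurd (hinj e) (by decide)
  have h12 : p 1 ≠ p 2 := fun e => absurd (hinj e) (by decide)
  have key : ∀ j : Fin 3, x = p j → x = a ∨ x = b ∨ x = p (k + 1) ∨ x = p (k + 2) := by
    intro j hj
    rcases ht3_fin3_cases k j with e | e | e
    · exact absurd (hj.trans (by rw [e])) hx
    · exact Or.inr (Or.inr (Or.inl (by rw [hj, e])))
    · exact Or.inr (Or.inr (Or.inr (by rw [hj, e])))
  rcases ht3_fl_cover (p 0) (p 1) (p 2) a b hab (ha 0) (ha 1) (ha 2) (hb 0) (hb 1) (hb 2) h01 h02 h12 x with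
    e | e | e | e | e
  · exact Or.inl e
  · exact Or.inr (Or.inl e)
  · exact key 0 e
  · exact key 1 e
  · exact key 2 e

/-- **NON-CROSSING at reference `p k`** (the loop lemma read in `σ_k`). [cite: KhristoforovSmirnov2021, §1.2 Lemma 2] -/
theorem ht3_nc (k : Fin 3) {a b : Fin 5} (hab : a ≠ b) (ha : ∀ k', a ≠ p k') (hb : ∀ k', b ≠ p k')
    (rab : (sideGraph ζ).Reachable (yc D a) (yc D b)) : Ht3NC a b (p k) (p (k + 1)) (p (k + 2)) := by
  obtain ⟨σ, hσ⟩ := ht3_exists_sigma hv hq hp k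
  obtain ⟨hk1, hk2, hk12⟩ := ht3_fin3_ne k
  obtain ⟨f1, f2, f4, f21, f41⟩ := ht3_fin5_facts (p k)
  have hinj := ht3_p_injective hv hq hp
  have hp1 : p (k + 1) ≠ p k := fun e => hk1 (hinj e)
  have hp2 : p (k + 2) ≠ p k := fun e => hk2 (hinj e)
  have hp12 : p (k + 1) ≠ p (k + 2) := fun e => hk12 (hinj e)
  have link_ab : (sideGraph (ht3Lk ζ v k)).Reachable (yc D a) (yc D b) :=
    ht3_Lk_reach_of_reach hq k (fun h => ha k (ht3_opp_corner hv hq hp h)) rab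
  have link_pp := ht3_Lk_reach_pp hv hq hp k
  -- the link of `y_{p k + 1}` to `y_y` forces the pair
  have key : ∀ y : Fin 5, y ≠ p k → y ≠ p k + 1 → (sideGraph (ht3Lk ζ v k)).Reachable (yc D (p k + 1)) (yc D y) →
      Ht3LP a b (p (k + 1)) (p (k + 2)) (p k + 1) y := by
    intro y hy hy1 hr
    rcases ht3_cover_k hv hq hp k hab ha hb (p k + 1) f1 with e | e | e | e
    · by_cases hyb : y = b
      · exact Or.inl ⟨e, hyb⟩
      · exfalso
        rw [e] at hr hy1
        exact ht3_Lk_no_three hv hq hp k (ha k) (hb k) hy hab (Ne.symm hy1) (Ne.symm hyb) link_ab hr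
    · by_cases hya : y = a
      · exact Or.inr (Or.inl ⟨e, hya⟩)
      · exfalso
        rw [e] at hr hy1
        exact ht3_Lk_no_three hv hq hp k (hb k) (ha k) hy hab.symm (Ne.symm hy1) (Ne.symm hya) link_ab.symm hr
    · by_cases hy2 : y = p (k + 2)
      · exact Or.inr (Or.inr (Or.inl ⟨e, hy2⟩))
      · exfalso
        rw [e] at hr hy1
        exact ht3_Lk_no_three hv hq hp k hp1 hp2 hy hp12 (Ne.symm hy1) (Ne.symm hy2) link_pp hr
    · by_cases hy2 : y = p (k + 1)
      · exact Or.inr (Or.inr (Or.inr ⟨e, hy2⟩))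
      · exfalso
        rw [e] at hr hy1
        exact ht3_Lk_no_three hv hq hp k hp2 hp1 hy hp12.symm (Ne.symm hy1) (Ne.symm hy2) link_pp.symm hr
  -- the loop lemma in `σ_k`
  have reach_of_chain : ∀ {i i' : Fin 5} {Y Y' : HexVertex}, IsCornerFace D i Y → IsCornerFace D i' Y' →
      Relation.ReflTransGen (IStep D σ (p k) false) Y Y' → (sideGraph (ht3Lk ζ v k)).Reachable (yc D i) (yc D i') := by
    intro i i' Y Y' hY hY' hc
    rw [eq_yc D hY, eq_yc D hY'] at hc
    rw [← xiLinked_iff_reachable, ← hσ, xiLinked_xiOf_iff]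
    exact hc
  rcases (fiveMarkedLoopLemma_holds D σ (p k)).1 with ⟨⟨Y1, Y2, hY1, hY2, hc⟩, -⟩ | ⟨⟨Y1, Y4, hY1, hY4, hc⟩, -⟩
  · exact Or.inl (key (p k + 2) f2 f21 (reach_of_chain hY1 hY2 hc))
  · exact Or.inr (key (p k + 4) f4 f41 (reach_of_chain hY1 hY4 hc))

omit hq hp in
/-- an `L_k`-step between faces other than `v` is a step of the core. [cite: KhristoforovSmirnov2021, Lemma 4 (discrete holomorphicity: the triple bijection at a vertex)] -/
theorem ht3_core_adj_of_Lk_adj (k : Fin 3) {F F' : HexVertex} (h : (sideGraph (ht3Lk ζ v k)).Adj F F') (hF : F ≠ v) (hF' : F' ≠ v) :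
    (sideGraph ζ).Adj F F' := by
  classical
  obtain ⟨j, hFj, hmem⟩ := h
  unfold ht3Lk at hmem
  rcases Finset.mem_union.1 hmem with hz | hx
  · exact ⟨j, hFj, ht3_zk_subset ζ v k hz⟩
  · exfalso
    obtain ⟨i, -, he⟩ := Finset.mem_image.1 hx
    have hFt : F ∈ triFacesTouching D.verts := mem_touching_of_side_mem D (he ▸ ht2_side_mem_hBonds D hv i)
    rcases (l3_exists_side_eq_iff D (ht2_side_mem_hBonds D hv i) hFt).1 ⟨j, he.symm⟩ with h1 | h1
    · exact hF h1
    · apply hF'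
      have hjidx : j = oppIdx v i := by
        rw [h1, ← side_oppFace_oppIdx v i] at he
        exact (side_injective _ he).symm
      rw [hFj, h1, hjidx, oppFace_oppFace]

/-! #### HT3-3. Chirality, I: the deleted path is white in `σ_k`, the lone hexagon at `v` is black -/

omit hv hq hp in
/-- the outer colours under reference `r`, colour `false`. [folklore] -/
private theorem arcColour_false_table (r : Fin 5) :
    arcColour r false (r + 1) = true ∧ arcColour r false (r + 2) = false ∧ arcColour r false (r + 3) = true ∧
      arcColour r false (r + 4) = false ∧ arcColour r false r = false := by
  revert r; decide

/-- **the path of `oppFace v k` is WHITE in `σ_k`**: every vertex in `G` of a face on it is closed. The corner `y_{p k}` sees the two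
arcs `p k - 1`, `p k` of colour `c = false` across non-bicoloured sides; colours propagate along the path across non-bicoloured
bonds (the faces of the path have no side in `L_k = ξ(σ_k)`). [cite: BollobasRiordan2006, Ch. 7 Lemma 5 pp. 169–171] -/
theorem ht3_white (k : Fin 3) {σ : SiteConfig (Site 2)} (hσ : xiOf D σ (p k) false = ht3Lk ζ v k) {F : HexVertex}
    (hF : (sideGraph ζ).Reachable (oppFace v k) F) {w : Fin 3} (hw : faceVertex F w ∈ D.verts) : faceVertex F w ∉ σ := by
  classical
  obtain ⟨hζ, -⟩ := ha_core_sub D hq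
  have hFy : (sideGraph ζ).Reachable F (yc D (p k)) := hF.symm.trans (hp k)
  rw [SimpleGraph.reachable_iff_reflTransGen] at hFy
  -- no side of a face on the path is bicoloured
  have mono : ∀ {a : HexVertex}, (sideGraph ζ).Reachable (oppFace v k) a → ∀ {i i' : Fin 3}, i ≠ i' →
      faceVertex a i ∈ D.verts → faceVertex a i ∉ σ → faceVertex a i' ∈ D.verts → faceVertex a i' ∉ σ := by
    intro a ha i i' hii' hi hiσ hi'
    obtain ⟨j, hj⟩ := ht3_pair_eq_side a hii'
    have hnot : s(faceVertex a i, faceVertex a i') ∉ xiOf D σ (p k) false := by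
      rw [hσ, hj]; exact ht3_no_side_of_reach hv hq hp k ha j
    have hadj : triGraph.Adj (faceVertex a i) (faceVertex a i') :=
      adj_of_mem_hexFaceVertices (faceVertex_mem a i) (faceVertex_mem a i') (fun e => hii' (faceVertex_injective a e))
    rw [mem_xiOf_iff' D σ (p k) false hadj (Or.inl hi), bicol_iff_of_mem_mem D σ (p k) false hi hi'] at hnot
    intro hin
    exact hnot (iff_of_false hiσ (fun h' => h' hin))
  have key : ∀ a : HexVertex, Relation.ReflTransGen (sideGraph ζ).Adj a (yc D (p k)) →
      (sideGraph ζ).Reachable (oppFace v k) a → ∀ w : Fin 3, faceVertex a w ∈ D.verts → faceVertex a w ∉ σ := by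
    intro a hab
    induction hab using Relation.ReflTransGen.head_induction_on with
    | refl =>
      -- the corner `y_{p k}`: its site `v_{p k}` is white (arcs `p k - 1`, `p k` are white under `c = false`)
      intro hra w hw
      obtain ⟨w₀, h0, h1, h2, hor⟩ := isCornerFace_typeII D (yc_spec D (p k))
      have hww : w = w₀ := by
        rcases ht3_fin3_cases w₀ w with e | e | e
        · exact e
        · exact absurd (e ▸ hw) h1
        · exact absurd (e ▸ hw) h2
      subst hww
      have e1 : w + 2 + 1 = w := fin3_add_two_add_one w
      have e2 : w + 2 + 2 = w + 1 := fin3_add_two_add_two w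
      have hside : s(faceVertex (yc D (p k)) w, faceVertex (yc D (p k)) (w + 1)) ∉ xiOf D σ (p k) false := by
        have := ht3_no_side_of_reach hv hq hp k hra (w + 2)
        unfold side at this
        rwa [e1, e2, ← hσ] at this
      have hadj : triGraph.Adj (faceVertex (yc D (p k)) w) (faceVertex (yc D (p k)) (w + 1)) := adj_faceVertex_succ _ w
      rw [mem_xiOf_iff' D σ (p k) false hadj (Or.inl hw), bicol_iff_of_mem_not_mem D σ (p k) false hw h1] at hside
      have harc : arcColour (p k) false (stretchIdx D (faceVertex (yc D (p k)) w, faceVertex (yc D (p k)) (w + 1))) = false := by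
        obtain ⟨-, -, -, c4, c0⟩ := arcColour_false_table (p k)
        rcases hor with ⟨hp1, -⟩ | ⟨hm1, -⟩
        · have hd : (faceVertex (yc D (p k)) w, faceVertex (yc D (p k)) (w + 1)) = predDart D (p k) :=
            Prod.ext (by rw [predDart_fst]; exact h0) hp1
          have e5 : p k - 1 = p k + 4 := by
            have : ∀ r : Fin 5, r - 1 = r + 4 := by decide
            exact this _
          rw [hd, stretchIdx_predDart, e5, c4]
        · have hd : (faceVertex (yc D (p k)) w, faceVertex (yc D (p k)) (w + 1)) = D.markDart (p k) := Prod.ext h0 hm1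
          rw [hd, stretchIdx_markDart, c0]
      rw [harc] at hside
      exact fun hin => hside (iff_of_true hin rfl)
    | head hac hcb ih =>
      rename_i a c
      intro hra w hw
      have hrc : (sideGraph ζ).Reachable (oppFace v k) c := hra.trans hac.reachable
      obtain ⟨j, hcj, hmem⟩ := hac
      -- a `G`-endpoint of the crossed bond, white as a vertex of `c`
      obtain ⟨x, y, hexy, hxG, -⟩ := exists_rep_of_mem_hBonds D (hζ hmem)
      have hx : x = faceVertex a (j + 1) ∨ x = faceVertex a (j + 2) := by
        unfold side at hexy
        rcases Sym2.eq_iff.1 hexy with ⟨h1, -⟩ | ⟨-, h2⟩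
        · exact Or.inl h1.symm
        · exact Or.inr h2.symm
      obtain ⟨i₁, hi₁⟩ : ∃ i₁ : Fin 3, x = faceVertex a i₁ := by
        rcases hx with h | h
        · exact ⟨j + 1, h⟩
        · exact ⟨j + 2, h⟩
      have hxσ : x ∉ σ := by
        rcases hx with h | h
        · have hc' : x = faceVertex c (oppIdx a j + 2) := by rw [hcj, faceVertex_oppFace_succ_succ]; exact h
          have := ih hrc (oppIdx a j + 2) (hc' ▸ hxG)
          rwa [← hc'] at this
        · have hc' : x = faceVertex c (oppIdx a j + 1) := by rw [hcj, faceVertex_oppFace_succ]; exact h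
          have := ih hrc (oppIdx a j + 1) (hc' ▸ hxG)
          rwa [← hc'] at this
      by_cases hwi : w = i₁
      · rw [hwi, ← hi₁]; exact hxσ
      · exact mono hra (Ne.symm hwi) (hi₁ ▸ hxG) (hi₁ ▸ hxσ) hw
  exact key F hFy hF w hw

/-- **the colours around `v` in `σ_k`**: the two hexagons of the side towards `oppFace v k` are white, the lone hexagon
`faceVertex v k` is black. [cite: BollobasRiordan2006, Ch. 7 Lemma 5 pp. 169–171] -/
theorem ht3_colours_at_v (k : Fin 3) {σ : SiteConfig (Site 2)} (hσ : xiOf D σ (p k) false = ht3Lk ζ v k) :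
    faceVertex v k ∈ σ ∧ faceVertex v (k + 1) ∉ σ ∧ faceVertex v (k + 2) ∉ σ := by
  classical
  obtain ⟨hk1, -, -⟩ := ht3_fin3_ne k
  have hr : (sideGraph ζ).Reachable (oppFace v k) (oppFace v k) := SimpleGraph.Reachable.refl _
  have c1 : faceVertex v (k + 1) ∉ σ := by
    have hmem : faceVertex (oppFace v k) (oppIdx v k + 2) ∈ D.verts := by
      rw [faceVertex_oppFace_succ_succ]; exact hv (faceVertex_mem v _)
    have := ht3_white hv hq hp k hσ hr hmem
    rwa [faceVertex_oppFace_succ_succ] at this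
  have c2 : faceVertex v (k + 2) ∉ σ := by
    have hmem : faceVertex (oppFace v k) (oppIdx v k + 1) ∈ D.verts := by
      rw [faceVertex_oppFace_succ]; exact hv (faceVertex_mem v _)
    have := ht3_white hv hq hp k hσ hr hmem
    rwa [faceVertex_oppFace_succ] at this
  refine ⟨?_, c1, c2⟩
  -- the side `side v (k+1) = {x_{k+2}, x_k}` is bicoloured
  have hmem : side v (k + 1) ∈ xiOf D σ (p k) false := by
    rw [hσ]; unfold ht3Lk
    exact Finset.mem_union_right _ (Finset.mem_image.2 ⟨k + 1, Finset.mem_erase.2 ⟨hk1, Finset.mem_univ _⟩, rfl⟩)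
  have e1 : k + 1 + 1 = k + 2 := fin3_add_one_add_one k
  have e2 : k + 1 + 2 = k := fin3_add_one_add_two k
  have hb := (mem_xiOf_iff D σ (p k) false v (k + 1)).1 hmem
  rw [e1, e2, bicol_iff_of_mem_mem D σ (p k) false (hv (faceVertex_mem v _)) (hv (faceVertex_mem v _))] at hb
  by_contra h0
  exact c2 (hb.2 h0)

omit hq hp in
/-- the entry side of `v` in the 4-marked colouring of `D.forget r`, given the colours at `v`: the side towards `oppFace v (k+1)`. [cite: BollobasRiordan2006, Ch. 7 Lemma 5 p. 170 (oriented interface)] -/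
theorem ht3_entry_idx (k : Fin 3) {σ : SiteConfig (Site 2)} (c1 : faceVertex v (k + 1) ∉ σ)
    (c2 : faceVertex v (k + 2) ∉ σ) (r : Fin 5) {j' : Fin 3} (hE : (D.forget r).IsEntry σ v j') : j' = k + 1 := by
  classical
  rw [(D.forget r).isEntry_iff] at hE
  obtain ⟨-, hf, ht⟩ := hE
  unfold TriMarkedDomain.vcol at ht
  simp only [TriMarkedDomain.forget_verts] at ht
  rw [if_pos (hv (faceVertex_mem v _))] at ht
  rcases ht3_fin3_cases k j' with e | e | e
  · rw [e] at ht; exact absurd (of_decide_eq_true ht) c2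
  · exact e
  · rw [e, fin3_add_two_add_two] at ht; exact absurd (of_decide_eq_true ht) c1

/-! #### HT3-4. Chirality, II: Bollobás–Riordan's oriented interface walk from `y_{p k + 1}` enters `v` from `oppFace v (k+1)` -/

omit hv hq hp in
/-- (H) bookkeeping. [folklore] -/
private theorem ht3_bcolOf_cases {i : Fin 4} (h1 : TriMarkedDomain.bcolOf (i - 1) = true) (h2 : TriMarkedDomain.bcolOf i = false) :
    i = 1 ∨ i = 3 := by
  revert i; decide

/-- **CHIRALITY at the neighbour with partner `p k`**: if `y_{p k + 1}` lies on the path through `v` then it is the corner of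
`oppFace v (k+1)`. The walk from `y_{p k + 1}` (`TriDiscInterface` on `D.forget (p k)`, open set `σ_k`) keeps black on its right;
it must visit `v` (else it would be a core chain from `y_{p k + 1}` to another corner), it enters `v` through the unique entry side,
which is the side towards `oppFace v (k+1)` because `faceVertex v k` is black; its initial segment is a core chain from `y_{p k + 1}`
to `oppFace v (k+1)`. [cite: BollobasRiordan2006, Ch. 7 Lemma 5 pp. 169–171, Fig. 9] -/
theorem ht3_chi (k : Fin 3) : Ht3Chi (p k) (p (k + 1)) (p (k + 2)) := by
  classical
  intro hcase
  obtain ⟨σ, hσ⟩ := ht3_exists_sigma hv hq hp k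
  obtain ⟨-, c1, c2⟩ := ht3_colours_at_v hv hq hp k hσ
  obtain ⟨-, f2, f4, f21, f41⟩ := ht3_fin5_facts (p k)
  -- the walk
  set D' := D.forget (p k) with hD'
  set f := D'.ifaceNext σ with hf
  set s₀ := D'.startFace with hs₀def
  obtain ⟨n, hsteps, hend⟩ := exists_partialOrbit_end f (triFacesTouching D'.verts) s₀ D'.startFace_mem
    (fun x _ y hy => D'.ifaceNext_mem hy) (fun x _ x' _ y hy hy' => D'.ifaceNext_injective hy hy')
    (fun x _ hx => by
      obtain ⟨j, hj, he⟩ := D'.ifaceNext_eq_some hx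
      have := D'.isEntry_oppFace hj
      rw [← he] at this
      exact D'.not_isEntry_startFace _ this)
  have hs₀ : s₀ = yc D (p k + 1) := eq_yc D (isCornerFace_startFace D (p k))
  -- every step is an `L_k`-step
  have hadjL : ∀ t, t < n → (sideGraph (ht3Lk ζ v k)).Adj (partialOrbit f s₀ t) (partialOrbit f s₀ (t + 1)) := by
    intro t ht
    obtain ⟨j, hX, he⟩ := D'.ifaceNext_eq_some (hsteps t ht)
    obtain ⟨j', hF', hb⟩ := (iStep_iff D σ (p k) false _ _).1 (iStep_of_isExit D σ (p k) hX)
    refine ⟨j', by rw [he, ← hF'], ?_⟩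
    rw [← hσ]
    exact (mem_xiOf_iff D σ (p k) false _ j').2 hb
  -- the start has an exit, so `n ≥ 1`; every later face is entered; the last face is terminal: a corner `y_m`, `m ∈ {pk+2, pk+4}`
  obtain ⟨v₀, j₀, -, -, -, -, -, -, hX₀, -⟩ := D'.exists_isExit_startFace (B := σ)
  have hn : n ≠ 0 := by
    rintro rfl
    exact D'.ifaceNext_ne_none hX₀ hend
  have hend_corner : ∃ m : Fin 5, (m = p k + 2 ∨ m = p k + 4) ∧ IsCornerFace D m (partialOrbit f s₀ n) := by
    obtain ⟨t', ht'⟩ : ∃ t', n = t' + 1 := ⟨n - 1, by omega⟩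
    obtain ⟨j', hX, he⟩ := D'.ifaceNext_eq_some (hsteps t' (by omega))
    have hE : D'.IsEntry σ (partialOrbit f s₀ n) (oppIdx (partialOrbit f s₀ t') j') := by
      rw [ht', he]; exact D'.isEntry_oppFace hX
    obtain ⟨i, w, hw, hw1, hw2, hs1, hs2, hb1, hb2, -, -⟩ :=
      terminal_typeII D σ (p k) hE (fun j'' => D'.ifaceNext_eq_none hend j'')
    set F := partialOrbit f s₀ n with hF
    have hd₁ : (faceVertex F w, faceVertex F (w + 1)) ∈ triBdryDarts D.verts := faceDart_mem₅ hw hw1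
    have hd₂ : (faceVertex F w, faceVertex F (w + 2)) ∈ triBdryDarts D.verts := by
      have e4 : w + 2 + 1 = w := by rw [add_assoc]; exact add_eq_left.2 (by decide)
      have := faceDart_mem₅' (j := w + 2) (by rw [e4]; exact hw) hw2
      rwa [e4] at this
    have hm1 := mem_forget_stretch D (p k) hd₁
    have hm2 := mem_forget_stretch D (p k) hd₂
    rw [hs1] at hm1
    rw [hs2] at hm2
    rcases ht3_bcolOf_cases hb1 hb2 with rfl | rfl
    · have g1 := (posIdx_of_mem_forget_stretch D (p k) hm1).1 (by decide)
      have g2 := (posIdx_of_mem_forget_stretch D (p k) hm2).2.1 rfl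
      obtain ⟨m, hm, -, hcorner⟩ := typeII_corner D hw hw1 hw2 (by
        rw [g1, g2]; exact (by decide : ∀ r : Fin 5, r + 1 ≠ r + 2) (p k))
      rw [g2] at hm
      exact ⟨m, Or.inl hm.symm, hcorner⟩
    · have g1 := (posIdx_of_mem_forget_stretch D (p k) hm1).2.2.1 (by decide)
      have g2 := (posIdx_of_mem_forget_stretch D (p k) hm2).2.2.2 rfl
      obtain ⟨m, hm, hm', hcorner⟩ := typeII_corner D hw hw1 hw2 (by
        rw [g1]; rcases g2 with h | h
        · rw [h]; exact (by decide : ∀ r : Fin 5, r + 3 ≠ r + 4) (p k)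
        · rw [h]; exact (by decide : ∀ r : Fin 5, r + 3 ≠ r) (p k))
      have hm4 : m = p k + 4 := by
        rcases g2 with h | h
        · exact hm.symm.trans h
        · exfalso
          rw [g1] at hm'
          rw [← hm, h] at hm'
          exact absurd hm' ((by decide : ∀ r : Fin 5, r + 3 ≠ r - 1) (p k))
      exact ⟨m, Or.inr hm4, hcorner⟩
  -- the corner `y_{p k + 1}` sees no corner in the core: it is the corner of a neighbour
  have hno_corner : ∀ m : Fin 5, m ≠ p k + 1 → ¬ (sideGraph ζ).Reachable (yc D (p k + 1)) (yc D m) := by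
    intro m hm hreach
    rcases hcase with e | e
    · rw [e] at hreach hm
      exact ht2_no_three D hq (ht2_opp_touching D hv (k + 1)) (ht2_odd_opp D hv hq (Finset.mem_univ _)) (ht2_odd_yc D hq _)
        (ht2_odd_yc D hq m) (hp (k + 1)) ((hp (k + 1)).trans hreach) (ht2_opp_ne_yc D hv _ _) (ht2_opp_ne_yc D hv _ _)
        (fun e' => hm (yc_injective D e').symm)
    · rw [e] at hreach hm
      exact ht2_no_three D hq (ht2_opp_touching D hv (k + 2)) (ht2_odd_opp D hv hq (Finset.mem_univ _)) (ht2_odd_yc D hq _)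
        (ht2_odd_yc D hq m) (hp (k + 2)) ((hp (k + 2)).trans hreach) (ht2_opp_ne_yc D hv _ _) (ht2_opp_ne_yc D hv _ _)
        (fun e' => hm (yc_injective D e').symm)
  -- a `v`-free initial segment of the walk is a core chain
  have hchain : ∀ t, (∀ t', t' ≤ t → t' ≤ n ∧ partialOrbit f s₀ t' ≠ v) → (sideGraph ζ).Reachable s₀ (partialOrbit f s₀ t) := by
    intro t
    induction t with
    | zero => intro _; exact SimpleGraph.Reachable.refl _
    | succ t ih =>
      intro h
      have h' := fun t' (ht' : t' ≤ t) => h t' (by omega)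
      exact (ih h').trans (ht3_core_adj_of_Lk_adj hv k (hadjL t (by have := (h (t + 1) le_rfl).1; omega))
        (h t (by omega)).2 (h (t + 1) le_rfl).2).reachable
  -- the walk visits `v`
  have hvisit : ∃ t, t ≤ n ∧ partialOrbit f s₀ t = v := by
    by_contra hno
    push Not at hno
    obtain ⟨m, hm, hcorner⟩ := hend_corner
    have hreach := hchain n (fun t' ht' => ⟨ht', hno t' ht'⟩)
    rw [eq_yc D hcorner, hs₀] at hreach
    have hm1 : m ≠ p k + 1 := by
      rcases hm with rfl | rfl
      · exact f21
      · exact f41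
    exact hno_corner m hm1 hreach
  -- the first visit
  let t₀ := Nat.find hvisit
  have ht₀ : t₀ ≤ n ∧ partialOrbit f s₀ t₀ = v := Nat.find_spec hvisit
  have hmin : ∀ t, t < t₀ → ¬ (t ≤ n ∧ partialOrbit f s₀ t = v) := fun t ht => Nat.find_min hvisit ht
  have ht₀0 : t₀ ≠ 0 := by
    intro h0
    have hv0 : partialOrbit f s₀ 0 = v := by rw [← h0]; exact ht₀.2
    exact ht2_yc_ne_v D hv (p k + 1) (hs₀ ▸ hv0)
  obtain ⟨t₁, ht₁⟩ : ∃ t₁, t₀ = t₁ + 1 := ⟨t₀ - 1, by omega⟩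
  have hpre : (sideGraph ζ).Reachable s₀ (partialOrbit f s₀ t₁) :=
    hchain t₁ (fun t' ht' => ⟨by omega, fun e => hmin t' (by omega) ⟨by omega, e⟩⟩)
  -- the step into `v`: through the entry side `k + 1`, from `oppFace v (k+1)`
  obtain ⟨j, hX, he⟩ := D'.ifaceNext_eq_some (hsteps t₁ (by omega))
  have hveq : oppFace (partialOrbit f s₀ t₁) j = v := by rw [← he, ← ht₁]; exact ht₀.2
  have hE : D'.IsEntry σ v (oppIdx (partialOrbit f s₀ t₁) j) := by
    have := D'.isEntry_oppFace hX
    rwa [hveq] at this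
  have hidx := ht3_entry_idx hv k c1 c2 (p k) hE
  have hw : partialOrbit f s₀ t₁ = oppFace v (k + 1) := by
    have := oppFace_oppFace (partialOrbit f s₀ t₁) j
    rw [hveq, hidx] at this
    exact this.symm
  have hreach : (sideGraph ζ).Reachable (oppFace v (k + 1)) (yc D (p k + 1)) := by
    rw [← hs₀, ← hw]; exact hpre.symm
  exact (ht3_opp_corner hv hq hp hreach).symm

/-! #### HT3-5. The classes of the three completions; HT3; (H) for every five-marked domain -/

/-- in the completion at `k` the corners of the two other neighbours are linked through `v`. [cite: KhristoforovSmirnov2021, Lemma 4 (discrete holomorphicity: the triple bijection at a vertex)] -/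
theorem ht3_compl_reach_pp (k : Fin 3) :
    (sideGraph (coreCompl v Finset.univ k ζ)).Reachable (yc D (p (k + 1))) (yc D (p (k + 2))) := by
  obtain ⟨-, hside⟩ := ha_core_sub D hq
  obtain ⟨hk1, hk2, -⟩ := ht3_fin3_ne k
  unfold coreCompl
  exact (ht2_reach_attach D hv hside (Finset.univ.erase k) (ht2_yc_ne_v D hv (p (k + 1))) (yc D (p (k + 2)))).2
    (Or.inl ⟨ht2_yc_ne_v D hv (p (k + 2)), Or.inr ⟨k + 1, Finset.mem_erase.2 ⟨hk1, Finset.mem_univ _⟩, k + 2,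
      Finset.mem_erase.2 ⟨hk2, Finset.mem_univ _⟩, (hp (k + 1)).symm, hp (k + 2)⟩⟩)

omit hv hp in
/-- core links survive in every completion. [cite: KhristoforovSmirnov2021, §1.2 (loop configurations, pp. 3–4)] -/
theorem ht3_compl_reach_of_reach (k : Fin 3) {Y Y' : HexVertex} (h : (sideGraph ζ).Reachable Y Y') :
    (sideGraph (coreCompl v Finset.univ k ζ)).Reachable Y Y' := by
  have := hq
  unfold coreCompl
  exact h.mono (ht2_sideGraph_mono Finset.subset_union_left)

/-- **class `(p k, A)`** of the completion at `k`, given the link `y_{p k + 1} ~ y_{p k + 2}` in it. [cite: KhristoforovSmirnov2021, Lemma 4 (discrete holomorphicity: the triple bijection at a vertex)] -/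
theorem ht3_complClass_A (k : Fin 3)
    (hlink : (sideGraph (coreCompl v Finset.univ k ζ)).Reachable (yc D (p k + 1)) (yc D (p k + 2))) :
    ComplClass D v Finset.univ k ζ (p k) false := by
  have hmem := ht2_coreCompl_mem_T6at D hv hq k
  rw [ht2_mem_T6at_iff] at hmem
  unfold ComplClass
  rw [ht2_inClass_iff]
  refine ⟨hmem.1, hmem.2, ?_, ?_⟩
  · unfold coreEnd
    rw [if_pos (Finset.mem_univ k)]
    exact ht3_compl_reach_of_reach hq k (hp k)
  · unfold patm
    rw [xiLinked_iff_reachable, if_neg Bool.false_ne_true]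
    exact hlink

/-- **class `(p k, B)`** of the completion at `k`, given the link `y_{p k + 1} ~ y_{p k + 4}` in it. [cite: KhristoforovSmirnov2021, Lemma 4 (discrete holomorphicity: the triple bijection at a vertex)] -/
theorem ht3_complClass_B (k : Fin 3)
    (hlink : (sideGraph (coreCompl v Finset.univ k ζ)).Reachable (yc D (p k + 1)) (yc D (p k + 4))) :
    ComplClass D v Finset.univ k ζ (p k) true := by
  have hmem := ht2_coreCompl_mem_T6at D hv hq k
  rw [ht2_mem_T6at_iff] at hmem
  unfold ComplClass
  rw [ht2_inClass_iff]
  refine ⟨hmem.1, hmem.2, ?_, ?_⟩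
  · unfold coreEnd
    rw [if_pos (Finset.mem_univ k)]
    exact ht3_compl_reach_of_reach hq k (hp k)
  · unfold patm
    rw [xiLinked_iff_reachable, if_pos rfl]
    exact hlink

end Reduced

omit D in
/-- index bookkeeping in `Fin 3` and `Fin 5` for the assembly. [cite: BollobasRiordan2006, Ch. 7 §7.2.2 pp. 168–171] -/
private theorem ht3_idx :
    ((0 : Fin 3) + 1 = 1 ∧ (0 : Fin 3) + 2 = 2 ∧ (1 : Fin 3) + 1 = 2 ∧ (1 : Fin 3) + 2 = 0 ∧ (2 : Fin 3) + 1 = 0 ∧ (2 : Fin 3) + 2 = 1) ∧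
    ∀ c : Fin 5, c + 2 + 1 = c + 3 ∧ c + 2 + 2 = c + 4 ∧ c + 3 + 1 = c + 4 ∧ c + 3 + 4 = c + 2 ∧ c + 4 + 1 = c ∧
      c + 4 + 2 = c + 1 ∧ c + 2 ≠ c + 3 ∧ c + 4 ≠ c + 3 := by
  refine ⟨by decide, ?_⟩
  decide

/-- **HT3 `ReLinkingTriples` holds for every five-marked domain**: at an interior face whose three neighbours are odd and
linked to three corners, the two remaining corners are adjacent and linked, the partners increase anticlockwise, and the three
completions have the classes `(c+2, A)`, `(c+3, B)`, `(c+4, A)`. [cite: KhristoforovSmirnov2021, Lemma 4 (discrete holomorphicity: the triple bijection at a vertex)] -/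
theorem reLinkingTriples_holds : ReLinkingTriples D := by
  classical
  intro v hv ζ hq p hpX
  have hp : ∀ k, (sideGraph ζ).Reachable (oppFace v k) (yc D (p k)) := fun k => (xiLinked_iff_reachable _ _ _).1 (hpX k)
  obtain ⟨⟨i01, i02, i11, i12, i21, i22⟩, hc5⟩ := ht3_idx
  -- the two free corners
  obtain ⟨a, ha0, ha1, ha2⟩ := ht3_fl_free (p 0) (p 1) (p 2)
  have ha : ∀ k, a ≠ p k := by
    intro k
    rcases ht3_fin3_cases 0 k with rfl | rfl | rfl
    · exact ha0
    · rw [i01]; exact ha1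
    · rw [i02]; exact ha2
  obtain ⟨b, hba, hb, rab⟩ := ht3_free_partner hv hq hp ha
  have hab : a ≠ b := hba.symm
  have hinj := ht3_p_injective hv hq hp
  have h01 : p 0 ≠ p 1 := fun e => absurd (hinj e) (by decide)
  have h02 : p 0 ≠ p 2 := fun e => absurd (hinj e) (by decide)
  have h12 : p 1 ≠ p 2 := fun e => absurd (hinj e) (by decide)
  -- three non-crossing and three chirality conditions
  have n0 := ht3_nc hv hq hp 0 hab ha hb rab
  have n1 := ht3_nc hv hq hp 1 hab ha hb rab
  have n2 := ht3_nc hv hq hp 2 hab ha hb rab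
  have x0 := ht3_chi hv hq hp 0
  have x1 := ht3_chi hv hq hp 1
  have x2 := ht3_chi hv hq hp 2
  rw [i01, i02] at n0 x0
  rw [i11, i12] at n1 x1
  rw [i21, i22] at n2 x2
  obtain ⟨c, hab', hrot⟩ := ht3_fl_main (p 0) (p 1) (p 2) a b hab ha0 ha1 ha2 (hb 0) (hb 1) (hb 2) h01 h02 h12
    n0 n1 n2 x0 x1 x2
  obtain ⟨e21, e22, e31, e34, e41, e42, n23, n43⟩ := hc5 c
  -- the left-over corners `y_c`, `y_{c+1}` are linked in the core
  have rc : (sideGraph ζ).Reachable (yc D c) (yc D (c + 1)) := by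
    rcases hab' with ⟨rfl, rfl⟩ | ⟨rfl, rfl⟩
    · exact rab
    · exact rab.symm
  -- the rotation
  obtain ⟨rot, h0, h1, h2⟩ : ∃ rot : Fin 3, p rot = c + 2 ∧ p (rot + 1) = c + 3 ∧ p (rot + 2) = c + 4 := by
    rcases hrot with ⟨e0, e1, e2⟩ | ⟨e1, e2, e0⟩ | ⟨e2, e0, e1⟩
    · exact ⟨0, e0, by rw [i01]; exact e1, by rw [i02]; exact e2⟩
    · exact ⟨1, e1, by rw [i11]; exact e2, by rw [i12]; exact e0⟩
    · exact ⟨2, e2, by rw [i21]; exact e0, by rw [i22]; exact e1⟩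
  refine ⟨c, rot, (xiLinked_iff_reachable _ _ _).2 rc, h0, h1, h2, fun k => ?_⟩
  -- the classes of the three completions
  rcases ht3_fin3_cases rot k with hk | hk | hk <;> rw [hk]
  · -- `k = rot`: partner `c + 2`, the other two corners `c+3`, `c+4` merge through `v`: class A
    have hd : decide (p rot = c + 3) = false := by rw [h0]; exact decide_eq_false n23
    rw [hd]
    apply ht3_complClass_A hv hq hp rot
    have := ht3_compl_reach_pp hv hq hp rot
    rw [h1, h2] at this
    rw [h0, e21, e22]
    exact this
  · -- `k = rot + 1`: partner `c + 3`, the corners `c+4`, `c+2` merge through `v`: class B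
    have hd : decide (p (rot + 1) = c + 3) = true := by rw [h1]; exact decide_eq_true rfl
    rw [hd]
    apply ht3_complClass_B hv hq hp (rot + 1)
    have := ht3_compl_reach_pp hv hq hp (rot + 1)
    rw [fin3_add_one_add_one, fin3_add_one_add_two, h2, h0] at this
    rw [h1, e31, e34]
    exact this
  · -- `k = rot + 2`: partner `c + 4`, the left-over corners `c`, `c+1` are linked in the core: class A
    have hd : decide (p (rot + 2) = c + 3) = false := by rw [h2]; exact decide_eq_false n43
    rw [hd]
    apply ht3_complClass_A hv hq hp (rot + 2)
    rw [h2, e41, e42]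
    exact ht3_compl_reach_of_reach hq (rot + 2) rc

/-- **(H) FIVE-POINT DISCRETE HOLOMORPHICITY FOR EVERY FIVE-MARKED DOMAIN** (the lane's typed statement (H), spelled out): around every
interior face `v`, for every colour `c` and reference index `j`, `Σ_{k : Fin 3} τ^k · F_j(v, ccwNbr v k) = 0` — from the four faces
HT1–HT4 through the assembly `hexFivePointHolomorphy_of_faces`. [cite: KhristoforovSmirnov2021, Lemma 4 (discrete holomorphicity), five-disorder analogue] -/
theorem hexFivePointHolomorphy_holds (D : TriMarkedDomain 5) (c : Bool) (j : Fin 5) (v : HexVertex)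
    (hv : hexFaceVertices v ⊆ D.verts) : ∑ k : Fin 3, tau ^ (k : ℕ) * sparseObs D j c v (ccwNbr v k) = 0 :=
  hexFivePointHolomorphy_of_faces D (coreDecomposition_holds D) (invariantTriples_holds D) (reLinkingTriples_holds D)
    tripleAlgebra_holds c j v hv

end N5

end Literature.Probability.Percolation.FivePoint
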